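import Mathlib
import Summits.Ventures.PercRepro2.K5K3Tables

/-!
# THE TYPED `K₃` BASE ON `K₅` FROM THE KERNEL CERTIFICATE
(blind cell PercRepro2, typer-1 g10; lead g26 03:29:09Z «K5TypedK3», p2's subtraction 03:22:27Z)

By `K5K3Tables.K3_apply`, on `K₅` with the marks `(0, 1, 2, 3, b)` the kernel `K₃ x y w` is a signed sum of
twenty products of tables, so a typed count `typedCount F z τ K₃` is the signed triple count of the profile
`k` of the minor `(F, z, τ)` (`typedCount_K3_eq`: `cntPos3 b k − cntNeg3 b k`).  The kernel certificate
`Cert3 b` (`K5K3Kernel.lean`) reads the counts off the base-`KB` digits of `kPos3 b`, `kNeg3 b`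
(`le_of_kron_le'`: the digits of `kNeg3 b` are below `2^19` by the third mask test, the counts are below
`KB`, so the subtraction borrows nowhere), hence

* **`cntNeg3_le_cntPos3`**: `Cert3 b → ∀ k, cntNeg3 b k ≤ cntPos3 b k`;
* **`typedCount_K3_nonneg_of_cert`**: `Cert3 b →` every weight-free typed count of `K₃` on `K₅` at the
  marks `(0, 1, 2, 3, b)` is `≥ 0` — all minors `(F, z)`, all type maps;
* **`typedBases_K5_of_cert`**: `Cert3 b → CovForm.TypedBases ends5 0 1 2 3 b` (row 2′TRI on `K₅`).

The three certificates (`b = 4` distinct marks, `b = 3` the coincidence `b = a₃`, `b = 0` the coincidence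
`o = b`) are `K5K3Cert4.lean` / `K5K3Cert3.lean` / `K5K3Cert0.lean`; their instantiations and the transfer
to every all-marked typed graph are in `K5K3Transfer.lean` / `K5TypedK3Marks.lean`.
-/

namespace Summit.Ventures.PercRepro2

open Hub

namespace K5

/-! ## Typed counts are signed triple counts -/

section Counts

variable {R : Type*} [Field R]

/-- The positive triple counts of `K₃` on `K₅` at the marks `(0, 1, 2, 3, b)`. -/
def cntPos3 (b : ℕ) (k : Fin 10 → Fin 4) : ℕ :=
  cnt3 tPD tQ (t4p b) k + cnt3 tQ tPDoU (t5p b) k + cnt3 tPD tQ (t6m b) k +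
    cnt3 tPD (t7p b) (t7m 0) k + cnt3 tPD (t7m b) (t7p 0) k +
    cnt3 tPDoU (t7p b) (t7m 3) k + cnt3 tPDoU (t7m b) (t7p 3) k +
    cnt3 tPD (t7p b) t10p k + cnt3 tPD (t7m b) t10m k + cnt3 tQ (t12 b) tPDoU k

/-- The negative triple counts of `K₃` on `K₅` at the marks `(0, 1, 2, 3, b)`. -/
def cntNeg3 (b : ℕ) (k : Fin 10 → Fin 4) : ℕ :=
  cnt3 tPD tQ (t4m b) k + cnt3 tQ tPDoU (t5m b) k + cnt3 tPD tQ (t6p b) k +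
    cnt3 tPD (t7p b) (t7p 0) k + cnt3 tPD (t7m b) (t7m 0) k +
    cnt3 tPDoU (t7p b) (t7p 3) k + cnt3 tPDoU (t7m b) (t7m 3) k +
    cnt3 tPD (t7p b) t10m k + cnt3 tPD (t7m b) t10p k + cnt3 tPD tQ (t11 b) k

/-- The typed count of a product of three tables is the triple count of the profile. -/
lemma typedCount_tables (F : Finset (Fin 10)) (z : Config (Fin 10)) (τ : Fin 10 → ℕ)
    (k : Fin 10 → Fin 4) (hk : ∀ e, (k e : ℕ) = if e ∈ F then τ e else if z e then 3 else 0)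
    (T₁ T₂ T₃ : (Fin 10 → Bool) → Bool) :
    typedCount F z τ (fun x y w => indR (R := R) T₁ x * indR T₂ y * indR T₃ w) =
      ((cnt3 T₁ T₂ T₃ k : ℕ) : R) := by
  rw [← coef3_eq_cnt3]
  unfold typedCount coef3
  simp only [typed_constraint_iff F z τ k hk, Finset.sum_filter, Fintype.sum_prod_type]

/-- A typed count is linear in the kernel (sums). -/
lemma typedCount_add (F : Finset (Fin 10)) (z : Config (Fin 10)) (τ : Fin 10 → ℕ)
    (K K' : Config (Fin 10) → Config (Fin 10) → Config (Fin 10) → R) :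
    typedCount F z τ (fun x y w => K x y w + K' x y w) = typedCount F z τ K + typedCount F z τ K' := by
  unfold typedCount
  simp only [← Finset.sum_add_distrib]
  refine Finset.sum_congr rfl fun x _ => Finset.sum_congr rfl fun y _ =>
    Finset.sum_congr rfl fun w _ => ?_
  split_ifs <;> simp

/-- A typed count is linear in the kernel (differences). -/
lemma typedCount_sub (F : Finset (Fin 10)) (z : Config (Fin 10)) (τ : Fin 10 → ℕ)
    (K K' : Config (Fin 10) → Config (Fin 10) → Config (Fin 10) → R) :
    typedCount F z τ (fun x y w => K x y w - K' x y w) = typedCount F z τ K - typedCount F z τ K' := by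
  unfold typedCount
  simp only [← Finset.sum_sub_distrib]
  refine Finset.sum_congr rfl fun x _ => Finset.sum_congr rfl fun y _ =>
    Finset.sum_congr rfl fun w _ => ?_
  split_ifs <;> simp

/-- **A typed count of `K₃` on `K₅` is the signed triple count of its profile.** -/
lemma typedCount_K3_eq (b : Fin 5) (F : Finset (Fin 10)) (z : Config (Fin 10)) (τ : Fin 10 → ℕ)
    (k : Fin 10 → Fin 4) (hk : ∀ e, (k e : ℕ) = if e ∈ F then τ e else if z e then 3 else 0) :
    typedCount F z τ (CovForm.K3 (R := R) ends5 0 1 2 3 b) =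
      ((cntPos3 b k : ℕ) : R) - ((cntNeg3 b k : ℕ) : R) := by
  have hK : CovForm.K3 (R := R) ends5 0 1 2 3 b = fun x y w =>
      (indR tPD x * indR tQ y * indR (t4p b) w + indR tQ x * indR tPDoU y * indR (t5p b) w +
        indR tPD x * indR tQ y * indR (t6m b) w +
        indR tPD x * indR (t7p b) y * indR (t7m 0) w + indR tPD x * indR (t7m b) y * indR (t7p 0) w +
        indR tPDoU x * indR (t7p b) y * indR (t7m 3) w + indR tPDoU x * indR (t7m b) y * indR (t7p 3) w +
        indR tPD x * indR (t7p b) y * indR t10p w + indR tPD x * indR (t7m b) y * indR t10m w +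
        indR tQ x * indR (t12 b) y * indR tPDoU w) -
      (indR tPD x * indR tQ y * indR (t4m b) w + indR tQ x * indR tPDoU y * indR (t5m b) w +
        indR tPD x * indR tQ y * indR (t6p b) w +
        indR tPD x * indR (t7p b) y * indR (t7p 0) w + indR tPD x * indR (t7m b) y * indR (t7m 0) w +
        indR tPDoU x * indR (t7p b) y * indR (t7p 3) w + indR tPDoU x * indR (t7m b) y * indR (t7m 3) w +
        indR tPD x * indR (t7p b) y * indR t10m w + indR tPD x * indR (t7m b) y * indR t10p w +
        indR tPD x * indR tQ y * indR (t11 b) w) := by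
    funext x y w
    exact K3_apply b x y w
  rw [hK, typedCount_sub]
  simp only [typedCount_add, typedCount_tables F z τ k hk]
  unfold cntPos3 cntNeg3
  push_cast
  ring

end Counts

/-! ## The digit bridge -/

section Digits

/-- Ten Kronecker sums combine (coefficient functions abstract, as in `K5Digits.sum_add_mul5`). -/
lemma sum_add_mul10 (f₁ f₂ f₃ f₄ f₅ f₆ f₇ f₈ f₉ f₁₀ : (Fin 10 → Fin 4) → ℕ) :
    ∑ k, f₁ k * KB ^ idx4 k + ∑ k, f₂ k * KB ^ idx4 k + ∑ k, f₃ k * KB ^ idx4 k +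
      ∑ k, f₄ k * KB ^ idx4 k + ∑ k, f₅ k * KB ^ idx4 k + ∑ k, f₆ k * KB ^ idx4 k +
      ∑ k, f₇ k * KB ^ idx4 k + ∑ k, f₈ k * KB ^ idx4 k + ∑ k, f₉ k * KB ^ idx4 k +
      ∑ k, f₁₀ k * KB ^ idx4 k =
      ∑ k, (f₁ k + f₂ k + f₃ k + f₄ k + f₅ k + f₆ k + f₇ k + f₈ k + f₉ k + f₁₀ k) * KB ^ idx4 k := by
  simp only [← Finset.sum_add_distrib]
  exact Finset.sum_congr rfl fun k _ => by ring

/-- `kPos3 b` carries the positive counts. -/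
lemma kPos3_eq (b : ℕ) : kPos3 b = ∑ k, cntPos3 b k * KB ^ idx4 k := by
  unfold kPos3
  simp only [kron_eq_kronSum, kronSum_mul_mul]
  rw [sum_add_mul10]
  rfl

/-- `kNeg3 b` carries the negative counts. -/
lemma kNeg3_eq (b : ℕ) : kNeg3 b = ∑ k, cntNeg3 b k * KB ^ idx4 k := by
  unfold kNeg3
  simp only [kron_eq_kronSum, kronSum_mul_mul]
  rw [sum_add_mul10]
  rfl

/-- `KB = 1048576`. -/
lemma KB_val : KB = 1048576 := by rw [KB_eq]; norm_num

/-- The positive counts are below `KB` (ten counts `≤ 3^10`). -/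
lemma cntPos3_lt (b : ℕ) (k : Fin 10 → Fin 4) : cntPos3 b k < KB := by
  unfold cntPos3
  rw [KB_val]
  have := cnt3_le tPD tQ (t4p b) k
  have := cnt3_le tQ tPDoU (t5p b) k
  have := cnt3_le tPD tQ (t6m b) k
  have := cnt3_le tPD (t7p b) (t7m 0) k
  have := cnt3_le tPD (t7m b) (t7p 0) k
  have := cnt3_le tPDoU (t7p b) (t7m 3) k
  have := cnt3_le tPDoU (t7m b) (t7p 3) k
  have := cnt3_le tPD (t7p b) t10p k
  have := cnt3_le tPD (t7m b) t10m k
  have := cnt3_le tQ (t12 b) tPDoU k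
  omega

/-- The negative counts are below `KB`. -/
lemma cntNeg3_lt (b : ℕ) (k : Fin 10 → Fin 4) : cntNeg3 b k < KB := by
  unfold cntNeg3
  rw [KB_val]
  have := cnt3_le tPD tQ (t4m b) k
  have := cnt3_le tQ tPDoU (t5m b) k
  have := cnt3_le tPD tQ (t6p b) k
  have := cnt3_le tPD (t7p b) (t7p 0) k
  have := cnt3_le tPD (t7m b) (t7m 0) k
  have := cnt3_le tPDoU (t7p b) (t7p 3) k
  have := cnt3_le tPDoU (t7m b) (t7m 3) k
  have := cnt3_le tPD (t7p b) t10m k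
  have := cnt3_le tPD (t7m b) t10p k
  have := cnt3_le tPD tQ (t11 b) k
  omega

/-- **The digit argument with the third mask test**: if `P = Σ_k a k KB^{idx4 k}`,
`M = Σ_k b k KB^{idx4 k}` with `a, b < KB`, `M ≤ P`, `Nat.land (P − M) mask = 0` and
`Nat.land M mask = 0`, then `b k ≤ a k` for every profile `k` (the digits of `M` are the `b k`, hence
`< 2^19` by the mask; the digits of `P − M` are `< 2^19` by the mask; so `P = (P − M) + M` digit by
digit without carry). -/
theorem le_of_kron_le' (a b : (Fin 10 → Fin 4) → ℕ) (ha : ∀ k, a k < KB) (hb : ∀ k, b k < KB)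
    {P M : ℕ} (hP : P = ∑ k, a k * KB ^ idx4 k) (hM : M = ∑ k, b k * KB ^ idx4 k) (hle : M ≤ P)
    (hmask : Nat.land (P - M) mask = 0) (hmaskM : Nat.land M mask = 0) (k : Fin 10 → Fin 4) :
    b k ≤ a k := by
  have hKB : 2 ≤ KB := by rw [KB_eq]; norm_num
  -- the digits of `M` are the `b`'s, hence below `2^19`
  have hb' : ∀ k, b k < 2 ^ 19 := by
    intro k
    have hj : idx4 k < 4 ^ 10 := idx4_lt k
    have h1 : M / KB ^ idx4 k % KB = b k := by
      rw [hM, sum_profiles_eq]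
      rw [digit_sum hKB (fun j => b (decode4 j)) (4 ^ 10) (fun j _ => hb _) (idx4 k) hj, decode4_idx4]
    rw [← h1]
    exact digit_lt_of_land_mask hmaskM hj
  set D := P - M with hD
  have hDM : P = D + M := by omega
  have hdlt : ∀ j < 4 ^ 10, D / KB ^ j % KB < 2 ^ 19 := fun j hj => digit_lt_of_land_mask hmask hj
  have hPlt : P < KB ^ (4 ^ 10) := by
    rw [hP, sum_profiles_eq]
    exact sum_lt_pow hKB _ _ fun j _ => ha _
  have hDlt : D < KB ^ (4 ^ 10) := by omega
  have hDsum := expand_digits hKB (4 ^ 10) D hDlt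
  have hPsum : P = ∑ j ∈ Finset.range (4 ^ 10), (D / KB ^ j % KB + b (decode4 j)) * KB ^ j := by
    rw [hDM, hM, sum_profiles_eq]
    conv_lhs => rw [hDsum]
    rw [← Finset.sum_add_distrib]
    exact Finset.sum_congr rfl fun j _ => by ring
  have hj : idx4 k < 4 ^ 10 := idx4_lt k
  have h1 : P / KB ^ idx4 k % KB = a k := by
    rw [hP, sum_profiles_eq]
    rw [digit_sum hKB (fun j => a (decode4 j)) (4 ^ 10) (fun j _ => ha _) (idx4 k) hj, decode4_idx4]
  have h2 : P / KB ^ idx4 k % KB = D / KB ^ idx4 k % KB + b k := by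
    rw [hPsum]
    rw [digit_sum hKB (fun j => D / KB ^ j % KB + b (decode4 j)) (4 ^ 10)
      (fun j hj' => by
        have := hdlt j hj'; have := hb' (decode4 j)
        have h2 : (2 : ℕ) ^ 19 + 2 ^ 19 = KB := by rw [KB_eq]; norm_num
        omega) (idx4 k) hj,
      decode4_idx4]
  have e : a k = D / KB ^ idx4 k % KB + b k := h1.symm.trans h2
  rw [e]
  exact Nat.le_add_left _ _

/-- **Every typed coefficient of `K₃` on `K₅` is `≥ 0`, given the certificate**:
`cntNeg3 b k ≤ cntPos3 b k`. -/
theorem cntNeg3_le_cntPos3 (b : ℕ) (hc : Cert3 b) (k : Fin 10 → Fin 4) : cntNeg3 b k ≤ cntPos3 b k :=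
  le_of_kron_le' (cntPos3 b) (cntNeg3 b) (cntPos3_lt b) (cntNeg3_lt b) (kPos3_eq b) (kNeg3_eq b)
    hc.1 hc.2.1 hc.2.2 k

end Digits

/-! ## The typed base -/

section Base

variable {R : Type*} [Field R] [LinearOrder R] [IsStrictOrderedRing R]

/-- **Every weight-free typed count of `K₃` on `K₅` at the marks `(0, 1, 2, 3, b)` is nonnegative**,
given the certificate `Cert3 b` — all minors `(F, z)`, all type maps. -/
theorem typedCount_K3_nonneg_of_cert (b : Fin 5) (hc : Cert3 b) (F : Finset (Fin 10))
    (z : Config (Fin 10)) (τ : Fin 10 → ℕ) :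
    0 ≤ typedCount F z τ (CovForm.K3 (R := R) ends5 0 1 2 3 b) := by
  by_cases hτ : ∀ e ∈ F, τ e ≤ 3
  · obtain ⟨k, hk⟩ := exists_profile F z τ hτ
    rw [typedCount_K3_eq b F z τ k hk, sub_nonneg]
    exact_mod_cast cntNeg3_le_cntPos3 b hc k
  · have : typedCount F z τ (CovForm.K3 (R := R) ends5 0 1 2 3 b) = 0 := by
      unfold typedCount
      refine Finset.sum_eq_zero fun x _ => Finset.sum_eq_zero fun y _ =>
        Finset.sum_eq_zero fun w _ => ?_
      rw [if_neg]
      rintro ⟨-, h2⟩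
      apply hτ
      intro e he
      rw [← h2 e he]
      unfold openCount
      have := Bool.toNat_le (x e)
      have := Bool.toNat_le (y e)
      have := Bool.toNat_le (w e)
      omega
    rw [this]

/-- **Row 2′TRI on `K₅` at the marks `(0, 1, 2, 3, b)`**, given the certificate `Cert3 b`. -/
theorem typedBases_K5_of_cert (b : Fin 5) (hc : Cert3 b) :
    CovForm.TypedBases (R := R) ends5 0 1 2 3 b :=
  fun F z τ _ => typedCount_K3_nonneg_of_cert b hc F z τ

end Base

end K5

end Summit.Ventures.PercRepro2
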